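import Mathlib.GroupTheory.ResiduallyFinite
import Literature.IUT.HodgeTheaters.TemperedCoveringsCompactSubgroups
import Literature.AnabelianGeometry.SemiGraphs.TemperedCompactPreimage
import HarnessLib

/-!
# [IUTchI] Prop. 2.1: the printed proof as a kernel inference over the universal pro-`Σ̂` covering

Mochizuki, *Inter-universal Teichmüller theory I*, kurims manuscript (May 2020), §2, Proposition 2.1
"Profinite Conjugates of Nontrivial Compact Subgroups", p. 45 — "the central technical result
underlying the theory of the present §2" ([IUTchI] Prop 2.1 p.45) [claim: Mochizuki2012, status:
disputed] (D-0012 claim key; nothing of the series is asserted here).  PROOF-ONLY companion of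
abc-iut-L5-t1's `TemperedCoverings.lean` (p405450): no new definition; the typed predicate
`TemperedGraphGroupData.ProfiniteConjugatesOfCompactSubgroups D` is PROVED from the inputs the
ten printed lines (p. 45, l. 27–37) invoke, each an explicit hypothesis stated where the text uses
it — on the vertices of "the pro-`Σ̂` semi-graph `Γ̂` associated to the universal pro-`Σ̂` étale
covering of `𝔾`" and its "tempered" vertices (images of `Γ^tp`):
* (A1) = [SemiAnbd] Thm 3.7 (iii) "there exist verticial subgroups `Λ′, Λ″ ⊆ Π^tp_𝔾` such that
  `Λ ⊆ Λ′`, `γ·Λ·γ⁻¹ ⊆ Λ″`" (the tree's `ProfiniteSemiGraph.CompactInVerticial`, L3 ladder G10);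
* (A3) = "[AbsTopII], Proposition 1.3, (iv), or [NodNon], Proposition 3.9, (i)": verticial
  subgroups of `Π̂_𝔾` meeting nontrivially belong to vertices of `Γ̂` that "are either equal or
  adjacent" — verbatim [NodNon] (Hoshi–Mochizuki 2011) Lemma 1.9 (ii) (1)(2)⇔(1′)(2′), p. 291:
  `Π_{ṽ₁} ∩ Π_{ṽ₂} ≠ {1} ⇒ d(ṽ₁, ṽ₂) ≤ 1`, read on the page; a FACT-policy input of campaign M
  (the [AbsTopII] typing `AbsoluteAnabelian.DPSCData.Prop13iv` records only the base-graph form);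
* (T2)/(T3) = the covering-space facts behind "since `v″` is tempered, … `(v′)^γ` is tempered.
  Thus, `v′, (v′)^γ` are tempered, so `γ ∈ Π^tp_𝔾`": a vertex equal or adjacent to a tempered
  vertex is tempered; if `ṽ`, `γ·ṽ` are both tempered then `γ ∈ Π^tp_𝔾` — PROVED in § C;
* (A0) = the step passed over in silence in "Since `Λ`, `γ·Λ·γ⁻¹` are compact subgroups of
  `Π^tp_𝔾`": `γ·Λ·γ⁻¹` is compact in `Π̂_𝔾` and lies in `ι(Π^tp_𝔾)`, but (A1) needs compactness for
  the TEMPERED topology (`ι` is a continuous injection, not an embedding).  PROVED in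
  `AnabelianGeometry/SemiGraphs/TemperedCompactPreimage.lean` (`IsTempered.isCompact_comap`,
  p408661) under (RF): the open normal subgroups of `Π^tp_𝔾` closed for the topology induced from
  `Π̂_𝔾` are cofinal — for `Π^tp_𝔾 = lim_i Gal(𝔾_{∞,i}/𝔾)` ([SemiAnbd] p. 38) this says the virtually
  free `Gal(𝔾_{∞,i}/𝔾)` are residually-`Σ̂`: residual finiteness when `Σ̂ = 𝔓𝔯𝔦𝔪𝔢𝔰` (Prop. 2.4 (ii),
  Cor. 2.5, [IUTchII]) — `closedBasis_of_residuallyFinite_quotients` below; for general `Σ̂` an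
  input the merge must supply (the text does not state it; flagged rather than assumed).

Main declarations (namespace `Literature.IUT.HodgeTheaters`):
* `closedBasis_of_residuallyFinite_quotients` — (RF) from the profinite topology + residually
  finite levels;
* `TemperedGraphGroupData.mem_range_of_proTree` — the argument for an admissible class `Adm` of
  compact subgroups (Prop. 2.1: all; proof of Prop. 2.4 (ii), p. 50: open image in `G_k`, with
  [SemiAnbd] Thm 5.4 (ii) and distance `≤ 2` as (A1)/(A3)), over an ABSTRACT set of pro-vertices
  with action map, equivariant stabilisers, `Near`, `IsTemperedVertex` — no model of `Γ̂` fixed, so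
  the merge may instantiate it on the L3 objects (`UniversalCovering`, `TemperedPiChart`);
  `prop21_of_proTree` = the case `Adm = ⊤`;
* `TemperedGraphGroupData.prop21_of_cosetTree` (§ C) — the same in COSET COORDINATES:
  `Vert(Γ̂) = ⊔_v Π̂_𝔾/Π_v` ([NodNon] Def 1.1 (ii), (vi): `Vert(Γ̃) = lim Vert(𝔾′)`, fibre
  `lim_N Π̂_𝔾/Π_v N = Π̂_𝔾/Π_v`, `Π_{g·ṽ_v} = g Π_v g⁻¹`), nodes over a node `e` of `𝔾` = the translates
  `k·ẽ_e` of one TEMPERED node with end-points `c₁(e)·ṽ_{src e}`, `c₂(e)·ṽ_{tgt e}`,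
  `cᵢ(e) ∈ Π^tp_𝔾`; here (T2), (T3), equivariance are PROVED, so Prop. 2.1 follows from exactly
  (A0), (A1), (A3)-in-coordinates; `…_of_isTempered` trades (A0) for (RF);
* `TemperedGraphGroupData.tp_isCommensurablyTerminal_of_cosetTree` — Prop. 2.2 "in particular"
  (`Π^tp_𝔾` commensurably terminal in `Π̂_𝔾`) from the same inputs plus one infinite compact `Λ_{v₀}`,
  through abc-iut-L5-t11's `tp_isCommensurablyTerminal_of_prop21'` (p407271).

What this file is NOT: not a discharge of the node IUTchI:Prop2.1 — (A1) is L3's Thm 3.7 (iii)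
(being proved on the G10 ladder), (A3) a FACT-policy input ([NodNon]/[AbsTopII]), (RF) a merge
obligation; the kernel check certifies that these, and nothing else, give Prop. 2.1 as typed.
Nothing here bears on [IUTchIII] Cor. 3.12; typed ≠ discharged.
-/

namespace Literature.IUT.HodgeTheaters

open Pointwise Filter
open _root_.Topology
open Literature.AnabelianGeometry.SemiGraphs (IsTempered)
open Literature.AnabelianGeometry.AbsoluteAnabelian (IsCommensurablyTerminal)

universe u

/-! ### (RF) from residual finiteness of the discrete quotients (the case `Σ̂ = 𝔓𝔯𝔦𝔪𝔢𝔰`) -/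

section RF

variable {T : Type*} [Group T] [TopologicalSpace T] [IsTopologicalGroup T]
  {P : Type*} [Group P] [TopologicalSpace P] [IsTopologicalGroup P] (ι : T →* P)

/-- **(RF) for the profinite topology.**  If every open subgroup of finite index of `T` is the
preimage of an open subgroup of `P` (true for `ι : T → T̂` the profinite completion of the
topological group `T` — the case `Σ̂ = 𝔓𝔯𝔦𝔪𝔢𝔰` of [IUTchI] §2 p. 44, `Π̂_𝔾` "the pro-`Σ̂` completion of
`Π^tp_𝔾`") and the countable discrete quotients `T/N` are residually finite for a cofinal family of
open normal `N` (for `Π^tp_𝔾 = lim_i Gal(𝔾_{∞,i}/𝔾)`, [SemiAnbd] p. 38: the `Gal(𝔾_{∞,i}/𝔾)` are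
virtually free, cf. the tree's `GroupTheory/CombinatorialGroupTheory/VirtuallyFreeResiduallyFinite`),
then the open normal subgroups of `T` closed for the topology induced from `P` are cofinal — the
hypothesis (RF) of `IsTempered.isCompact_comap`. [cite: Mochizuki2012, Prop 2.1 p.45] -/
theorem closedBasis_of_residuallyFinite_quotients
    (hPC : ∀ U : Subgroup T, IsOpen (U : Set T) → U.FiniteIndex →
      ∃ W : Subgroup P, IsOpen (W : Set P) ∧ W.comap ι = U)
    (hres : ∀ V ∈ 𝓝 (1 : T), ∃ N : OpenNormalSubgroup T, (N : Set T) ⊆ V ∧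
      Group.ResiduallyFinite (T ⧸ N.toSubgroup)) :
    ∀ V ∈ 𝓝 (1 : T), ∃ N : OpenNormalSubgroup T, (N : Set T) ⊆ V ∧
      ((N.toSubgroup.map ι).topologicalClosure).comap ι ≤ N.toSubgroup := by
  intro V hV
  obtain ⟨N, hNV, hRFN⟩ := hres V hV
  refine ⟨N, hNV, fun t ht => ?_⟩
  rw [Subgroup.mem_comap] at ht
  by_contra htN
  -- a finite-index open `U ⊇ N` missing `t`, from residual finiteness of `T/N`
  have ht1 : (t : T ⧸ N.toSubgroup) ≠ 1 := by
    rwa [Ne, QuotientGroup.eq_one_iff]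
  obtain ⟨H, hHfi, htH⟩ :=
    (Group.residuallyFinite_iff_exists_finiteIndex.mp hRFN) _ ht1
  set U : Subgroup T := H.comap (QuotientGroup.mk' N.toSubgroup) with hU
  have hNU : N.toSubgroup ≤ U := by
    intro n hn
    rw [hU, Subgroup.mem_comap, QuotientGroup.mk'_apply, (QuotientGroup.eq_one_iff n).mpr hn]
    exact H.one_mem
  have hUo : IsOpen (U : Set T) := Subgroup.isOpen_mono hNU N.toOpenSubgroup.isOpen
  haveI : U.FiniteIndex := ⟨by
    rw [hU, Subgroup.index_comap_of_surjective H (QuotientGroup.mk'_surjective N.toSubgroup)]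
    exact hHfi.1⟩
  obtain ⟨W, hWo, hWU⟩ := hPC U hUo inferInstance
  -- `ι(N) ⊆ W`, `W` is closed, so `closure ι(N) ⊆ W` and `t ∈ ι⁻¹(W) = U`
  have hNW : (N.toSubgroup.map ι).topologicalClosure ≤ W :=
    Subgroup.topologicalClosure_minimal _
      (Subgroup.map_le_iff_le_comap.mpr (hWU.symm ▸ hNU)) (Subgroup.isClosed_of_isOpen W hWo)
  have htU : t ∈ U := by
    rw [← hWU, Subgroup.mem_comap]
    exact hNW ht
  rw [hU, Subgroup.mem_comap, QuotientGroup.mk'_apply] at htU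
  exact htH htU

end RF

/-! ### B.  Proposition 2.1 from its printed inputs, over an abstract set of pro-vertices
(§ A = `AnabelianGeometry/SemiGraphs/TemperedCompactPreimage.lean`) -/

namespace TemperedGraphGroupData

variable (D : TemperedGraphGroupData.{u})

/-- **The argument of [IUTchI] Prop. 2.1, p. 45 l. 27–37, for an admissible class of compact
subgroups** (`Adm`; Prop. 2.1 is `Adm = ⊤`, the "arithmetic analogue" in the proof of Prop. 2.4 (ii),
p. 50, takes `Adm Λ` = "the image of `Λ` in `G_k` is open"), over an abstract set `Vtx` of
pro-vertices with action map `act`, equivariant stabilisers `stab`, a relation `Near` and a predicate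
`IsTemperedVertex` — see `prop21_of_proTree` for the dictionary with the text.  Hypotheses: (A0)
compact subgroups of `Π̂` inside `ι(Π^tp)` pull back to compact subgroups; `Adm` is stable under
`Λ ↦ ι⁻¹(γ ι(Λ) γ⁻¹)`; (A1) every admissible nontrivial compact `Λ` has `ι(Λ) ⊆ Π_ṽ` for a tempered
`ṽ` ([SemiAnbd] Thm 3.7 (iii), resp. Thm 5.4 (ii)); (A3) `Π_ṽ ∩ Π_w̃ ≠ {1} ⇒ Near ṽ w̃` ([NodNon]
Lem 1.9 (ii) / Prop 3.9 (i), [AbsTopII] Prop 1.3 (iv)); (T2) `Near ṽ w̃`, `w̃` tempered `⇒ ṽ`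
tempered; (T3) `ṽ`, `γ·ṽ` tempered `⇒ γ ∈ ι(Π^tp)`.  Conclusion: `γ·Λ·γ⁻¹ ⊆ ι(Π^tp) ⇒ γ ∈ ι(Π^tp)`.
([IUTchI] Prop 2.1 p.45) [claim: Mochizuki2012, status: disputed] -/
theorem mem_range_of_proTree (Adm : Subgroup D.Tp → Prop)
    (hA0 : ∀ K : Subgroup D.Hat, IsCompact (K : Set D.Hat) → K ≤ D.ι.range →
      IsCompact ((K.comap D.ι : Subgroup D.Tp) : Set D.Tp))
    (hAdm : ∀ (Λ : Subgroup D.Tp) (γ : D.Hat), Adm Λ → (∀ l ∈ Λ, γ * D.ι l * γ⁻¹ ∈ D.ι.range) →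
      Adm ((MulAut.conj γ • Λ.map D.ι).comap D.ι))
    {Vtx : Type*} (act : D.Hat → Vtx → Vtx) (stab : Vtx → Subgroup D.Hat)
    (stab_act : ∀ (γ : D.Hat) (x : Vtx), stab (act γ x) = MulAut.conj γ • stab x)
    (Near : Vtx → Vtx → Prop) (IsTemperedVertex : Vtx → Prop)
    (hA1 : ∀ Λ : Subgroup D.Tp, IsCompact (Λ : Set D.Tp) → Λ ≠ ⊥ → Adm Λ →
      ∃ x, IsTemperedVertex x ∧ Λ.map D.ι ≤ stab x)
    (hA3 : ∀ x y : Vtx, stab x ⊓ stab y ≠ ⊥ → Near x y)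
    (hT2 : ∀ x y : Vtx, Near x y → IsTemperedVertex y → IsTemperedVertex x)
    (hT3 : ∀ (γ : D.Hat) (x : Vtx), IsTemperedVertex x → IsTemperedVertex (act γ x) →
      γ ∈ D.ι.range)
    (Λ : Subgroup D.Tp) (hΛc : IsCompact (Λ : Set D.Tp)) (hΛne : Λ ≠ ⊥) (hΛa : Adm Λ)
    (γ : D.Hat) (hγ : ∀ l ∈ Λ, γ * D.ι l * γ⁻¹ ∈ D.ι.range) : γ ∈ D.ι.range := by
  -- `K := γ · ι(Λ) · γ⁻¹`, a compact subgroup of `Π̂_𝔾` contained in `ι(Π^tp_𝔾)`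
  set K : Subgroup D.Hat := MulAut.conj γ • Λ.map D.ι with hKdef
  have hKmem : ∀ {z : D.Hat}, z ∈ K ↔ ∃ l ∈ Λ, z = γ * D.ι l * γ⁻¹ := by
    intro z
    simp only [hKdef, Subgroup.mem_smul_pointwise_iff_exists, Subgroup.mem_map, MulAut.smul_def,
      MulAut.conj_apply]
    constructor
    · rintro ⟨_, ⟨l, hl, rfl⟩, rfl⟩
      exact ⟨l, hl, rfl⟩
    · rintro ⟨l, hl, rfl⟩
      exact ⟨D.ι l, ⟨l, hl, rfl⟩, rfl⟩
  have hKc : IsCompact (K : Set D.Hat) := by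
    have hcont : Continuous fun l : D.Tp => γ * D.ι l * γ⁻¹ :=
      (continuous_const.mul D.ι_continuous).mul continuous_const
    have : (K : Set D.Hat) = (fun l : D.Tp => γ * D.ι l * γ⁻¹) '' (Λ : Set D.Tp) := by
      ext z
      simp only [SetLike.mem_coe, Set.mem_image]
      rw [hKmem]
      constructor
      · rintro ⟨l, hl, rfl⟩
        exact ⟨l, hl, rfl⟩
      · rintro ⟨l, hl, rfl⟩
        exact ⟨l, hl, rfl⟩
    rw [this]
    exact hΛc.image hcont
  have hKr : K ≤ D.ι.range := by
    intro z hz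
    obtain ⟨l, hl, rfl⟩ := hKmem.mp hz
    exact hγ l hl
  have hKne : K ≠ ⊥ := by
    obtain ⟨l, hl, hl1⟩ : ∃ l ∈ Λ, l ≠ 1 := by
      by_contra h
      push Not at h
      exact hΛne ((Subgroup.eq_bot_iff_forall _).mpr h)
    intro hK
    have : γ * D.ι l * γ⁻¹ ∈ K := hKmem.mpr ⟨l, hl, rfl⟩
    rw [hK, Subgroup.mem_bot] at this
    have : D.ι l = 1 := by
      have h' : D.ι l = γ⁻¹ * (γ * D.ι l * γ⁻¹) * γ := by group
      rw [h', this]; group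
    exact hl1 (D.ι_injective (by rw [this, map_one]))
  -- `Λ₂ := ι⁻¹(K)`, compact (hypothesis (A0)) and nontrivial, with `ι(Λ₂) = K`
  set Λ₂ : Subgroup D.Tp := K.comap D.ι with hΛ₂def
  have hΛ₂c : IsCompact (Λ₂ : Set D.Tp) := hA0 K hKc hKr
  have hΛ₂map : Λ₂.map D.ι = K := Subgroup.map_comap_eq_self hKr
  have hΛ₂ne : Λ₂ ≠ ⊥ := by
    intro h
    apply hKne
    rw [← hΛ₂map, h, Subgroup.map_bot]
  -- [SemiAnbd] Thm 3.7 (iii): tempered vertices `x`, `y` with `ι(Λ) ≤ Π_x`, `K = ι(Λ₂) ≤ Π_y`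
  obtain ⟨x, hx, hΛx⟩ := hA1 Λ hΛc hΛne hΛa
  obtain ⟨y, hy, hΛy⟩ := hA1 Λ₂ hΛ₂c hΛ₂ne (hAdm Λ γ hΛa hγ)
  rw [hΛ₂map] at hΛy
  -- `K ≤ Π_{γ·x} ∩ Π_y`, so these two verticial subgroups meet nontrivially
  have h1 : K ≤ stab (act γ x) := by
    rw [stab_act]
    intro z hz
    obtain ⟨l, hl, rfl⟩ := hKmem.mp hz
    have : D.ι l ∈ stab x := hΛx (Subgroup.mem_map_of_mem _ hl)
    simpa only [MulAut.smul_def, MulAut.conj_apply] using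
      Subgroup.smul_mem_pointwise_smul (D.ι l) (MulAut.conj γ) (stab x) this
  have hne : stab (act γ x) ⊓ stab y ≠ ⊥ := by
    intro h
    exact hKne (le_bot_iff.mp (h ▸ le_inf h1 hΛy))
  -- [NodNon]: `γ·x`, `y` are equal or adjacent, so `γ·x` is tempered like `y`; conclude by (T3)
  exact hT3 γ x hx (hT2 _ _ (hA3 _ _ hne) hy)

/-- **[IUTchI] Proposition 2.1 from its printed inputs** (p. 45, l. 27–37) = `mem_range_of_proTree`
with every compact subgroup admissible.  Dictionary: `stab ṽ` = "the verticial subgroup `Π_ṽ ⊆ Π̂_𝔾`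
corresponding to `ṽ`"; `IsTemperedVertex ṽ` = "occurs as the image of a [pro-]vertex of `Γ^tp`";
(A1) l. 27–31, (A3) l. 31–35, (T2) l. 35–36, (T3) l. 36–37; the proof is the text's: `Λ ⊆ Π_{v′}`,
`γΛγ⁻¹ ⊆ Π_{v″}` with `v′, v″` tempered, `{1} ≠ γΛγ⁻¹ ⊆ Π_{γ·v′} ∩ Π_{v″}`, so `γ·v′` is equal or
adjacent to `v″`, hence tempered, hence `γ ∈ Π^tp_𝔾`.  Conclusion: abc-iut-L5-t1's predicate
`ProfiniteConjugatesOfCompactSubgroups D` AS TYPED.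
([IUTchI] Prop 2.1 p.45) [claim: Mochizuki2012, status: disputed] -/
theorem prop21_of_proTree
    (hA0 : ∀ K : Subgroup D.Hat, IsCompact (K : Set D.Hat) → K ≤ D.ι.range →
      IsCompact ((K.comap D.ι : Subgroup D.Tp) : Set D.Tp))
    {Vtx : Type*} (act : D.Hat → Vtx → Vtx) (stab : Vtx → Subgroup D.Hat)
    (stab_act : ∀ (γ : D.Hat) (x : Vtx), stab (act γ x) = MulAut.conj γ • stab x)
    (Near : Vtx → Vtx → Prop) (IsTemperedVertex : Vtx → Prop)
    (hA1 : ∀ Λ : Subgroup D.Tp, IsCompact (Λ : Set D.Tp) → Λ ≠ ⊥ →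
      ∃ x, IsTemperedVertex x ∧ Λ.map D.ι ≤ stab x)
    (hA3 : ∀ x y : Vtx, stab x ⊓ stab y ≠ ⊥ → Near x y)
    (hT2 : ∀ x y : Vtx, Near x y → IsTemperedVertex y → IsTemperedVertex x)
    (hT3 : ∀ (γ : D.Hat) (x : Vtx), IsTemperedVertex x → IsTemperedVertex (act γ x) →
      γ ∈ D.ι.range) :
    D.ProfiniteConjugatesOfCompactSubgroups :=
  ⟨fun Λ hΛc hΛne γ hγ => D.mem_range_of_proTree (fun _ => True) hA0 (fun _ _ _ _ => trivial)
    act stab stab_act Near IsTemperedVertex (fun Λ h1 h2 _ => hA1 Λ h1 h2) hA3 hT2 hT3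
    Λ hΛc hΛne trivial γ hγ⟩

/-! ### C.  The same in coset coordinates on `Π̂_𝔾` (the universal pro-`Σ̂` covering `Γ̂`) -/

/-- **[IUTchI] Proposition 2.1 in coset coordinates on `Γ̂`.**  Data (all inside `Π^tp_𝔾`, as
chosen from the tempered covering `Γ^tp`): for each vertex `v` of `𝔾` a verticial subgroup
`Λ_v ⊆ Π^tp_𝔾` (the stabiliser of a tempered vertex `ṽ_v` over `v`; `Π_v := ι(Λ_v)` is then the
verticial subgroup of `Π̂_𝔾` at `ṽ_v`, [SemiAnbd] Thm 3.7 (i)), and for each node `e` of `𝔾`, with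
end-vertices `src e`, `tgt e`, elements `c₁(e), c₂(e) ∈ Π^tp_𝔾` such that a tempered node `ẽ_e`
over `e` has end-points `c₁(e)·ṽ_{src e}`, `c₂(e)·ṽ_{tgt e}`.  Coordinates: the vertices of `Γ̂`
over `v` are the `g·ṽ_v`, `g ∈ Π̂_𝔾/Π_v` ([NodNon] Def 1.1 (ii), (vi): `Vert(Γ̃) = lim Vert(𝔾′)`,
fibre `lim_N Π̂_𝔾/Π_v N = Π̂_𝔾/Π_v`; `Π_{g·ṽ_v} = g Π_v g⁻¹`), the nodes over `e` are the `k·ẽ_e`,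
and `g·ṽ_v` is tempered iff `g ∈ ι(Π^tp_𝔾)`.  In these coordinates the covering-space facts (T2),
(T3) and the equivariance of stabilisers are PROVED below (group arithmetic), so Prop. 2.1 for `D`
follows from exactly: (A0) (see `IsTempered.isCompact_comap`); (A1) [SemiAnbd] Thm 3.7 (iii)
(with (i): the verticial subgroups at `v` are the conjugates of `Λ_v`): every nontrivial compact
`Λ ⊆ Π^tp_𝔾` lies in some `t Λ_v t⁻¹`, `t ∈ Π^tp_𝔾`; (A3) [NodNon] Lem 1.9 (ii) (1)(2)⇔(1′)(2′)
(= Prop 3.9 (i); [AbsTopII] Prop 1.3 (iv)) written out: if `g Π_v g⁻¹ ∩ h Π_w h⁻¹ ≠ {1}` then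
either `g·ṽ_v = h·ṽ_w` (`v = w`, `g⁻¹h ∈ Π_v`) or the two vertices are the end-points
`k c₁(e) ṽ_{src e}`, `k c₂(e) ṽ_{tgt e}` of a node `k·ẽ_e`.
([IUTchI] Prop 2.1 p.45) [claim: Mochizuki2012, status: disputed] -/
theorem prop21_of_cosetTree
    (hA0 : ∀ K : Subgroup D.Hat, IsCompact (K : Set D.Hat) → K ≤ D.ι.range →
      IsCompact ((K.comap D.ι : Subgroup D.Tp) : Set D.Tp))
    {V : Type*} (Λv : V → Subgroup D.Tp) {E : Type*} (src tgt : E → V) (c₁ c₂ : E → D.Tp)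
    (hA1 : ∀ Λ : Subgroup D.Tp, IsCompact (Λ : Set D.Tp) → Λ ≠ ⊥ →
      ∃ (v : V) (t : D.Tp), Λ ≤ MulAut.conj t • Λv v)
    (hA3 : ∀ (v w : V) (g h : D.Hat),
      MulAut.conj g • (Λv v).map D.ι ⊓ MulAut.conj h • (Λv w).map D.ι ≠ ⊥ →
        (v = w ∧ g⁻¹ * h ∈ (Λv v).map D.ι) ∨
        ∃ (e : E) (k : D.Hat), ∃ p ∈ (Λv (src e)).map D.ι, ∃ q ∈ (Λv (tgt e)).map D.ι,
          (src e = v ∧ tgt e = w ∧ g = k * D.ι (c₁ e) * p ∧ h = k * D.ι (c₂ e) * q) ∨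
          (src e = w ∧ tgt e = v ∧ h = k * D.ι (c₁ e) * p ∧ g = k * D.ι (c₂ e) * q)) :
    D.ProfiniteConjugatesOfCompactSubgroups := by
  -- pro-vertices in coordinates: `(v, g)` stands for the vertex `g · ṽ_v` of `Γ̂`
  refine D.prop21_of_proTree hA0 (Vtx := V × D.Hat) (fun γ x => (x.1, γ * x.2))
    (fun x => MulAut.conj x.2 • (Λv x.1).map D.ι) ?_
    (fun x y => (x.1 = y.1 ∧ x.2⁻¹ * y.2 ∈ (Λv x.1).map D.ι) ∨
      ∃ (e : E) (k : D.Hat), ∃ p ∈ (Λv (src e)).map D.ι, ∃ q ∈ (Λv (tgt e)).map D.ι,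
        (src e = x.1 ∧ tgt e = y.1 ∧ x.2 = k * D.ι (c₁ e) * p ∧ y.2 = k * D.ι (c₂ e) * q) ∨
        (src e = y.1 ∧ tgt e = x.1 ∧ y.2 = k * D.ι (c₁ e) * p ∧ x.2 = k * D.ι (c₂ e) * q))
    (fun x => x.2 ∈ D.ι.range) ?_ ?_ ?_ ?_
  · -- equivariance of the stabilisers: `Π_{γ·(g ṽ)} = γ Π_{g ṽ} γ⁻¹`
    intro γ x
    change MulAut.conj (γ * x.2) • (Λv x.1).map D.ι = MulAut.conj γ • MulAut.conj x.2 • (Λv x.1).map D.ι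
    rw [map_mul, mul_smul]
  · -- (A1) in coordinates
    intro Λ hΛc hΛne
    obtain ⟨v, t, ht⟩ := hA1 Λ hΛc hΛne
    refine ⟨(v, D.ι t), ⟨t, rfl⟩, ?_⟩
    change Λ.map D.ι ≤ MulAut.conj (D.ι t) • (Λv v).map D.ι
    rw [← map_conj_smul]
    exact Subgroup.map_mono ht
  · -- (A3) in coordinates
    rintro ⟨v, g⟩ ⟨w, h⟩ hne
    exact hA3 v w g h hne
  · -- (T2): a vertex equal or adjacent to a tempered vertex is tempered
    rintro ⟨v, g⟩ ⟨w, h⟩ hnear (hh : h ∈ D.ι.range)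
    change g ∈ D.ι.range
    have hΛle : ∀ u : V, (Λv u).map D.ι ≤ D.ι.range := fun u => Subgroup.map_le_range _ _
    rcases hnear with ⟨-, hgh⟩ | ⟨e, k, p, hp, q, hq, hcase⟩
    · -- same vertex: `g = h (g⁻¹ h)⁻¹`
      have : g = h * (g⁻¹ * h)⁻¹ := by group
      rw [this]
      exact D.ι.range.mul_mem hh (D.ι.range.inv_mem (hΛle _ hgh))
    · rcases hcase with ⟨-, -, hg', hh'⟩ | ⟨-, -, hh', hg'⟩
      · -- `g = k c₁ p`, `h = k c₂ q` with `h` tempered ⇒ `k` tempered ⇒ `g` tempered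
        simp only at hg' hh'
        have hk : k ∈ D.ι.range := by
          have : k = h * (D.ι (c₂ e) * q)⁻¹ := by rw [hh']; group
          rw [this]
          exact D.ι.range.mul_mem hh
            (D.ι.range.inv_mem (D.ι.range.mul_mem ⟨c₂ e, rfl⟩ (hΛle _ hq)))
        rw [hg']
        exact D.ι.range.mul_mem (D.ι.range.mul_mem hk ⟨c₁ e, rfl⟩) (hΛle _ hp)
      · simp only at hg' hh'
        have hk : k ∈ D.ι.range := by
          have : k = h * (D.ι (c₁ e) * p)⁻¹ := by rw [hh']; group
          rw [this]
          exact D.ι.range.mul_mem hh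
            (D.ι.range.inv_mem (D.ι.range.mul_mem ⟨c₁ e, rfl⟩ (hΛle _ hp)))
        rw [hg']
        exact D.ι.range.mul_mem (D.ι.range.mul_mem hk ⟨c₂ e, rfl⟩) (hΛle _ hq)
  · -- (T3): `g` and `γ g` both tempered ⇒ `γ` tempered
    rintro γ ⟨v, g⟩ (hg : g ∈ D.ι.range) (hγg : γ * g ∈ D.ι.range)
    have : γ = γ * g * g⁻¹ := by group
    rw [this]
    exact D.ι.range.mul_mem hγg (D.ι.range.inv_mem hg)

/-- `prop21_of_cosetTree` with (A0) DISCHARGED from temperedness of `Π^tp_𝔾`, Hausdorffness of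
`Π̂_𝔾` and (RF) (`IsTempered.isCompact_comap`): Prop. 2.1 for `D` from (A1) and (A3) in coset
coordinates. ([IUTchI] Prop 2.1 p.45) [claim: Mochizuki2012, status: disputed] -/
theorem prop21_of_cosetTree_of_isTempered [T2Space D.Hat] (hT : IsTempered D.Tp)
    (hRF : ∀ U ∈ 𝓝 (1 : D.Tp), ∃ N : OpenNormalSubgroup D.Tp, (N : Set D.Tp) ⊆ U ∧
      ((N.toSubgroup.map D.ι).topologicalClosure).comap D.ι ≤ N.toSubgroup)
    {V : Type*} (Λv : V → Subgroup D.Tp) {E : Type*} (src tgt : E → V) (c₁ c₂ : E → D.Tp)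
    (hA1 : ∀ Λ : Subgroup D.Tp, IsCompact (Λ : Set D.Tp) → Λ ≠ ⊥ →
      ∃ (v : V) (t : D.Tp), Λ ≤ MulAut.conj t • Λv v)
    (hA3 : ∀ (v w : V) (g h : D.Hat),
      MulAut.conj g • (Λv v).map D.ι ⊓ MulAut.conj h • (Λv w).map D.ι ≠ ⊥ →
        (v = w ∧ g⁻¹ * h ∈ (Λv v).map D.ι) ∨
        ∃ (e : E) (k : D.Hat), ∃ p ∈ (Λv (src e)).map D.ι, ∃ q ∈ (Λv (tgt e)).map D.ι,
          (src e = v ∧ tgt e = w ∧ g = k * D.ι (c₁ e) * p ∧ h = k * D.ι (c₂ e) * q) ∨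
          (src e = w ∧ tgt e = v ∧ h = k * D.ι (c₁ e) * p ∧ g = k * D.ι (c₂ e) * q)) :
    D.ProfiniteConjugatesOfCompactSubgroups :=
  D.prop21_of_cosetTree (hT.isCompact_comap D.ι D.ι_continuous D.ι_injective hRF)
    Λv src tgt c₁ c₂ hA1 hA3

/-- **Prop. 2.2, "in particular" — `Π^tp_𝔾` is commensurably terminal in `Π̂_𝔾`** (p. 45: "by allowing,
in Proposition 2.1, `Λ` to range over the open subgroups of any verticial [hence, in particular,
nontrivial compact!] subgroup of `Π^tp_𝔾`"), from the inputs of `prop21_of_cosetTree_of_isTempered`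
plus ONE infinite compact `Λ_{v₀}` (a verticial subgroup `≅ π̂₁(𝔾_{v₀})` is infinite profinite), via
abc-iut-L5-t11's elementary form `tp_isCommensurablyTerminal_of_prop21'` (p407271).
([IUTchI] Prop 2.2 p.45) [claim: Mochizuki2012, status: disputed] -/
theorem tp_isCommensurablyTerminal_of_cosetTree [T2Space D.Hat] (hT : IsTempered D.Tp)
    (hRF : ∀ U ∈ 𝓝 (1 : D.Tp), ∃ N : OpenNormalSubgroup D.Tp, (N : Set D.Tp) ⊆ U ∧
      ((N.toSubgroup.map D.ι).topologicalClosure).comap D.ι ≤ N.toSubgroup)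
    {V : Type*} (Λv : V → Subgroup D.Tp) {E : Type*} (src tgt : E → V) (c₁ c₂ : E → D.Tp)
    (hA1 : ∀ Λ : Subgroup D.Tp, IsCompact (Λ : Set D.Tp) → Λ ≠ ⊥ →
      ∃ (v : V) (t : D.Tp), Λ ≤ MulAut.conj t • Λv v)
    (hA3 : ∀ (v w : V) (g h : D.Hat),
      MulAut.conj g • (Λv v).map D.ι ⊓ MulAut.conj h • (Λv w).map D.ι ≠ ⊥ →
        (v = w ∧ g⁻¹ * h ∈ (Λv v).map D.ι) ∨
        ∃ (e : E) (k : D.Hat), ∃ p ∈ (Λv (src e)).map D.ι, ∃ q ∈ (Λv (tgt e)).map D.ι,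
          (src e = v ∧ tgt e = w ∧ g = k * D.ι (c₁ e) * p ∧ h = k * D.ι (c₂ e) * q) ∨
          (src e = w ∧ tgt e = v ∧ h = k * D.ι (c₁ e) * p ∧ g = k * D.ι (c₂ e) * q))
    (v₀ : V) (hv₀c : IsCompact ((Λv v₀ : Subgroup D.Tp) : Set D.Tp))
    (hv₀inf : ((Λv v₀ : Subgroup D.Tp) : Set D.Tp).Infinite) :
    IsCommensurablyTerminal D.ι.range := by
  haveI : T2Space D.Tp := hT.t2Space
  exact D.tp_isCommensurablyTerminal_of_prop21'
    (D.prop21_of_cosetTree_of_isTempered hT hRF Λv src tgt c₁ c₂ hA1 hA3) ⟨Λv v₀, hv₀c, hv₀inf⟩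

end TemperedGraphGroupData

end Literature.IUT.HodgeTheaters
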